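import Summits.Ventures.AbcSig.Rows.Statements
import Summits.Ventures.AbcSig.Rows.XnYn2Z2

/-!
# Venture AbcSig — CELL bridge for `xⁿ + yⁿ = 2 z²`: p1's census predicate `Rows.C1Cell 2 7 ∅`

HONEST FRAMING. COMPUTATION cell `pub-abcsig`; CONDITIONAL theorem; no claim on ABC or any summit. Hypotheses exactly
those of `Rows/XnYn2Z2.lean` (`row_XnYn2Z2`): `BS04Package` (CITED), `DataComplete` /
`Refines` (COMPUTED, certified level files), and the row's per-orbit CITED exclusions `hX_…` universally quantified in
the exponent. Conclusion = the census statement of the SIGNED row of record `census/rows/C1/C1-C2-all.md` in p1's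
vocabulary (`Rows/Statements.lean`): every prime `n ≥ 11`, `n ∤ 2`, no primitive solution with `|xy| > 1`.
GENERATED by p-lean gen3/make_c1cell.py (pattern of `Rows/BridgeC1P2.lean`).
-/

namespace Summit.Ventures.AbcSig

/-- `xⁿ + yⁿ = 2z²`, every prime `n ≥ 7` with `n ∤ 2`: p1's `Rows.C1Cell 2 7 ∅` from `row_XnYn2Z2`. -/
theorem C1Cell_2_of (M : NewformModel) (hP : M.BS04Package)
    (hD256 : M.DataComplete 256 level256Orbits)
    (hX_orbit_256_1 : ∀ n : ℕ, M.Excludes 256 orbit_256_1 (fun S => S.A = 1 ∧ S.B = 1 ∧ S.C = 2 ∧ S.n = n))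
    (hX_orbit_256_2 : ∀ n : ℕ, M.Excludes 256 orbit_256_2 (fun S => S.A = 1 ∧ S.B = 1 ∧ S.C = 2 ∧ S.n = n))
    (hX_orbit_256_3 : ∀ n : ℕ, M.Excludes 256 orbit_256_3 (fun S => S.A = 1 ∧ S.B = 1 ∧ S.C = 2 ∧ S.n = n))
    (hX_orbit_256_4 : ∀ n : ℕ, M.Excludes 256 orbit_256_4 (fun S => S.A = 1 ∧ S.B = 1 ∧ S.C = 2 ∧ S.n = n)) :
    Rows.C1Cell 2 7 ∅ :=
  fun n hn h11 _ _ x y z h1 h2 =>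
    row_XnYn2Z2 M hP hD256 n hn h11 (hX_orbit_256_1 n) (hX_orbit_256_2 n) (hX_orbit_256_3 n) (hX_orbit_256_4 n) x y z h1 h2

end Summit.Ventures.AbcSig
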